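import Literature.AlgebraicTopology.SingularHomology.CompactSupports
import Literature.AlgebraicTopology.SingularHomology.CompactSupport
import Literature.AlgebraicTopology.SingularHomology.ExcisionTheorem
import Literature.AlgebraicTopology.SingularHomology.DeformationRetractPairs
import HarnessLib

/-!
# Relative singular homology has compact supports in the space variable

A. Hatcher, *Algebraic Topology* (2002), §2.1 and §3.3 (proof of Prop. 3.33, p. 244: "a cycle in
`X` is a finite sum of singular simplices with compact image"; proof of Lemma 3.27 step (4)): a
relative cycle of `(X, A)` is a chain of `X` with compact carrier `C`, so its class comes from
`Hₙ(W, W ∩ A)` for every `W ⊇ C`. The tree has the absolute statement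
(`singularHomology.exists_isCompact_mem_range_map`, `CompactSupports.lean`) and the relative one in
the SUBSPACE variable (`relativeSingularHomology.exists_isCompact_forall_mem_range_map`: `Hᵢ(X, V) →
Hᵢ(X, U)`); this file proves the relative statement in the SPACE variable:

* `relativeSingularHomology.exists_isCompact_forall_mem_range_map_subspace` — for every
  `α ∈ Hₙ(X, A; M)` there is a compact `C ⊆ X` such that for every `W ⊇ C`, `α` is in the image
  of `Hₙ(↥W, W ↓∩ A; M) → Hₙ(X, A; M)` (the map of pairs induced by the inclusion `↥W → X`).

Proof in the concrete chain model (`csingularChainComplex`, `chainsInSub`, relative classes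
`Subcomplex.relCls`): a representing relative cycle `c` has compact carrier (`CChain.carrier`), is a
chain of every `W ⊇ carrier c` (`csingularChainComplex.exists_map_val_eq_of_carrier_subset`) with
boundary in `C(W ↓∩ A)` (`chainsInSub_preimage_val`), and classes are natural
(`Subcomplex.homologyMap_quotMap_relCls`, `relativeSingularHomology.map_eq_concrete`).

Consumer: generation of `H_k(X | S)` by local classes for a non-compact closed `S` (the cyclicity of
the Thom-degree local homology of the smooth part of a curve,
`Barriers/HodgeConjecture/IntegralCoefficientsCurvePurityHomology`). Everything is proved; no
definitions, no named facts.

## References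

* [HatcherAT2002] A. Hatcher, Algebraic Topology, CUP 2002, §3.3 proof of Prop. 3.33 (p. 244) and
  proof of Lemma 3.27 step (4) (p. 238); §2.1 (relative cycles).
-/

noncomputable section

-- as in `SingularChainsConcrete` / `LocalHomology`: chains of the concrete complex are `Finsupp`s
-- up to unfolding of semireducible definitions
set_option backward.isDefEq.respectTransparency false

open CategoryTheory Limits Set

universe u v

namespace Literature.AlgebraicTopology.SingularHomology

namespace relativeSingularHomology

variable (R : Type v) [CommRing R] (M : Type v) [AddCommGroup M] [Module R M]
variable {X : Type u} [TopologicalSpace X]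

/-- **Relative homology has compact supports in the space variable** (Hatcher 2002, §3.3 proofs
of Prop. 3.33 and of Lemma 3.27 step (4)): for `α ∈ Hₙ(X, A; M)` there is a compact `C ⊆ X` (the
carrier of a representing relative cycle) such that for every `W ⊇ C`, `α` is the image of a class
of `Hₙ(↥W, W ↓∩ A; M)` under the map of pairs induced by `↥W → X`.
[cite: HatcherAT2002, §3.3 proof of Prop. 3.33 (p. 244) and proof of Lemma 3.27 (4) (p. 238)] -/
theorem exists_isCompact_forall_mem_range_map_subspace (A : Set X) {n : ℕ}
    (α : relativeSingularHomology R M X A n) :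
    ∃ C : Set X, IsCompact C ∧ ∀ W : Set X, C ⊆ W →
      α ∈ Set.range (map R M (subsetIncl W) (mapsTo_subsetIncl_preimage W A) n :
        relativeSingularHomology R M (↥W) (Subtype.val ⁻¹' A) n ⟶ relativeSingularHomology R M X A n) := by
  -- a representing relative cycle in the concrete model
  set α' := (concreteIso R M X A n).hom α with hα'
  have hαα' : (concreteIso R M X A n).inv α' = α := by
    rw [hα', ← ModuleCat.comp_apply, Iso.hom_inv_id, ModuleCat.id_apply]
  obtain ⟨c, hc, hcα⟩ := (chainsInSub R M X A).relCls_surjective α'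
  refine ⟨CChain.carrier c, CChain.isCompact_carrier c, fun W hW ↦ ?_⟩
  -- `c` is a chain of `↥W` …
  obtain ⟨cW, hcW⟩ := csingularChainComplex.exists_map_val_eq_of_carrier_subset (R := R) c hW
  subst hcW
  -- … with boundary in `C(W ↓∩ A)`
  have hdW : (csingularChainComplex R M ↥W).d n ((ComplexShape.down ℕ).next n) cW ∈
      chainsInSub R M (↥W) (Subtype.val ⁻¹' A) ((ComplexShape.down ℕ).next n) := by
    rw [chainsInSub_preimage_val, Subcomplex.mem_comap, ← ModuleCat.comp_apply,
      ← (csingularChainComplex.map R M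
        (⟨Subtype.val, continuous_subtype_val⟩ : C(↥W, X))).comm, ModuleCat.comp_apply]
    exact hc
  -- its class maps to `α`
  refine ⟨(concreteIso R M (↥W) (Subtype.val ⁻¹' A) n).inv
    ((chainsInSub R M (↥W) (Subtype.val ⁻¹' A)).relCls cW hdW), ?_⟩
  rw [map_eq_concrete, ModuleCat.comp_apply, ModuleCat.comp_apply, Iso.inv_hom_id_apply,
    Subcomplex.homologyMap_quotMap_relCls, ← hαα', ← hcα]

end relativeSingularHomology

end Literature.AlgebraicTopology.SingularHomology

end
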